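import Summits.ValiantsHypothesis.ValiantsHypothesis.Theorems.NewtonUnitEquationsTwoProductsSubmergedDefs
import Summits.ValiantsHypothesis.ValiantsHypothesis.Theorems.NewtonUnitEquationsTwoProductsFormalLogLinearisationStubLogLinearisation

/-!
# K4 `submerged-band-filtration` — FIRST-ORDER BALANCE (val-idea-36 g0's L3)

`firstOrderBalance_holds : FirstOrderBalance` (text in `…SubmergedDefs`): in a non-empty SUBMERGED cell every tail letter `e` lies strictly
above the visible point, hence is a cancelled point of `∏(1+u_j) − ∏(1+v_j)` (strict top of the support, via the landed log-linearisation
`FormalLogLinearisation.stub_logLinearisation`); if `e` is NOT composite (no letter tuple with `≥ 2` non-zero slots has point `e`) then the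
`X^e`-coefficient of `∏(1+u_j)` is the column sum `Σ_j [X^e] u_j` (`coeff_prod_one_add_of_not_composite`: the only contributions to `X^e`
in the multi-affine expansion are the single-slot ones), so the two column sums balance.
Helper mode (`--supports stmt-ValiantsHypothesis-5906 --as helper`).  Honest framing: a linear identity satisfied by submerged cells
(infrastructure of the K4 reduction; generic coefficients violate it); nothing here closes 5906 (`TwoProducts` / `ResidualLawV23` /
`PlanarCellBound` OPEN); VP ≠ VNP is NOT proved.  No instances, no notation, no named facts. [folklore]
-/

noncomputable section
set_option linter.dupNamespace false

namespace Summit.ValiantsHypothesis.ValiantsHypothesis.Theorems.NewtonUnitEquations.TwoProducts.Submerged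
open scoped BigOperators
open MvPolynomial
open Summit.ValiantsHypothesis.ValiantsHypothesis.Theorems.NewtonUnitEquations.TwoProducts.FormalLogLinearisation
open Summit.ValiantsHypothesis.ValiantsHypothesis.Theorems.NewtonUnitEquations.TwoProducts.PlanarCell

variable {m : ℕ}

/-- Extending a partial letter tuple by one slot: if `x` is a support point of `∏_{i∈s}(1+u_i)` with `x ≠ 0` and `y` a letter of
position `a ∉ s`, then `x + y` is a COMPOSITE point of any letter family containing the supports. [folklore] -/
theorem isComposite_of_mem_support_prod (u : Fin m → MvPolynomial (Fin 2) ℂ) (A : Fin m → Finset Expo)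
    (hA : ∀ j, (u j).support ⊆ A j) (s : Finset (Fin m)) (a : Fin m) (ha : a ∉ s) {x y : Expo}
    (hx : x ∈ (∏ i ∈ s, (1 + u i)).support) (hx0 : x ≠ 0) (hy : y ∈ (u a).support) (hy0 : y ≠ 0) :
    IsComposite A (x + y) := by
  classical
  obtain ⟨g, hg0, hgs, hgsum⟩ := support_prod_one_add u s x hx
  obtain ⟨i₀, hi₀s, hi₀⟩ : ∃ i ∈ s, g i ≠ 0 := by
    by_contra hcon
    push Not at hcon
    exact hx0 (by rw [← hgsum]; exact Finset.sum_eq_zero hcon)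
  have hga : g a = 0 := hgs a ha
  refine ⟨Function.update g a y, ?_, ?_, ?_⟩
  · -- a letter tuple
    unfold tuples
    refine Fintype.mem_piFinset.2 fun j => ?_
    by_cases hj : j = a
    · subst hj
      simpa using Finset.mem_insert_of_mem (hA j hy)
    · rw [Function.update_of_ne hj]
      rcases Finset.mem_insert.1 (hg0 j) with h | h
      · rw [h]; exact Finset.mem_insert_self _ _
      · exact Finset.mem_insert_of_mem (hA j h)
  · -- its point is `x + y`
    have h1 : ∑ j, Function.update g a y j = ∑ j, g j + y := by
      rw [Finset.sum_update_of_mem (Finset.mem_univ a)]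
      have : ∑ j ∈ Finset.univ \ {a}, g j = ∑ j, g j := by
        rw [← Finset.sum_sdiff (Finset.subset_univ {a}), Finset.sum_singleton, hga, add_zero]
      rw [this, add_comm]
    have h2 : ∑ j, g j = x := by
      rw [← hgsum, ← Finset.sum_subset (Finset.subset_univ s) fun j _ hj => hgs j hj]
    rw [h1, h2]
  · -- two non-zero slots: `i₀` and `a`
    have hne : i₀ ≠ a := fun h => ha (h ▸ hi₀s)
    have hsub : ({i₀, a} : Finset (Fin m)) ⊆ Finset.univ.filter fun j => Function.update g a y j ≠ 0 := by
      intro j hj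
      rcases Finset.mem_insert.1 hj with rfl | hj
      · exact Finset.mem_filter.2 ⟨Finset.mem_univ _, by rwa [Function.update_of_ne hne]⟩
      · rw [Finset.mem_singleton] at hj
        subst hj
        exact Finset.mem_filter.2 ⟨Finset.mem_univ _, by rwa [Function.update_self]⟩
    calc 2 = ({i₀, a} : Finset (Fin m)).card := by rw [Finset.card_pair hne]
      _ ≤ _ := Finset.card_le_card hsub

/-- **The `X^e`-coefficient of `∏_{i∈s}(1+u_i)` at a NON-composite nonzero point `e` is the column sum `Σ_{i∈s} [X^e] u_i`.** [folklore] -/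
theorem coeff_prod_one_add_of_not_composite (u : Fin m → MvPolynomial (Fin 2) ℂ) (hu0 : ∀ j, coeff 0 (u j) = 0)
    (A : Fin m → Finset Expo) (hA : ∀ j, (u j).support ⊆ A j) (e : Expo) (he0 : e ≠ 0) (hne : ¬ IsComposite A e)
    (s : Finset (Fin m)) : coeff e (∏ i ∈ s, (1 + u i)) = ∑ i ∈ s, coeff e (u i) := by
  classical
  induction s using Finset.induction_on with
  | empty =>
    simp only [Finset.prod_empty, Finset.sum_empty, coeff_one]
    rw [if_neg (Ne.symm he0)]
  | insert a s ha ih =>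
    have hP0 : coeff 0 (∏ i ∈ s, (1 + u i)) = 1 := by
      have h : ∀ i, constantCoeff (u i) = 0 := fun i => by rw [constantCoeff_eq]; exact hu0 i
      have key : constantCoeff (∏ i ∈ s, (1 + u i)) = 1 := by
        rw [map_prod]
        exact Finset.prod_eq_one fun i _ => by rw [map_add, map_one, h i, add_zero]
      rwa [constantCoeff_eq] at key
    have hmul : coeff e (u a * ∏ i ∈ s, (1 + u i)) = coeff e (u a) := by
      rw [coeff_mul, Finset.sum_eq_single (e, 0)]
      · rw [hP0, mul_one]
      · intro p hp hpne
        have hsum : p.1 + p.2 = e := Finset.HasAntidiagonal.mem_antidiagonal.1 hp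
        by_cases h1 : coeff p.1 (u a) = 0
        · rw [h1, zero_mul]
        by_cases h2 : coeff p.2 (∏ i ∈ s, (1 + u i)) = 0
        · rw [h2, mul_zero]
        exfalso
        have hx0 : p.2 ≠ 0 := by
          intro h
          apply hpne
          refine Prod.ext ?_ h
          have := hsum
          rw [h, add_zero] at this
          exact this
        have hy0 : p.1 ≠ 0 := fun h => h1 (by rw [h]; exact hu0 a)
        have hc := isComposite_of_mem_support_prod u A hA s a ha (mem_support_iff.2 h2) hx0 (mem_support_iff.2 h1) hy0
        rw [add_comm, hsum] at hc
        exact hne hc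
      · intro h
        exact absurd (Finset.HasAntidiagonal.mem_antidiagonal.2 (by simp)) h
    rw [Finset.prod_insert ha, Finset.sum_insert ha, add_mul, one_mul, coeff_add, ih, hmul]
    ring

/-- **K4 L3 — FIRST-ORDER BALANCE** (`FirstOrderBalance`, val-idea-36 g0's text verbatim in `…SubmergedDefs`): in a non-empty submerged cell,
every NON-composite tail letter has balanced column sums `Σ_j [X^e] u_j = Σ_j [X^e] v_j`. [folklore] -/
theorem firstOrderBalance_holds : FirstOrderBalance := by
  intro m u v hu0 hv0 R S hS hne e he hnc
  classical
  obtain ⟨l, hl⟩ := hne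
  obtain ⟨ξ, hξ, htop, -, hsub⟩ := hS l hl
  have hF : IsStrictTop ξ (↑(tailDiff u v).support) l := (stub_logLinearisation m u v hu0 hv0 ξ hξ l).2 htop
  have hel : wt ξ l < wt ξ e := hsub e he
  have hcoeff : coeff e (tailDiff u v) = 0 := by
    by_contra h
    have hne' : e ≠ l := by
      rintro rfl
      exact lt_irrefl _ hel
    have := hF.2 e (Finset.mem_coe.2 (mem_support_iff.2 h)) hne'
    linarith
  have he0 : e ≠ 0 := by
    rintro rfl
    simp only [tailSupport, Finset.mem_union, Finset.mem_biUnion, Finset.mem_univ, true_and] at he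
    rcases he with ⟨j, hj⟩ | ⟨j, hj⟩
    · exact (mem_support_iff.1 hj) (hu0 j)
    · exact (mem_support_iff.1 hj) (hv0 j)
  have hPu := coeff_prod_one_add_of_not_composite u hu0 (fun j => (u j).support ∪ (v j).support)
    (fun j => Finset.subset_union_left) e he0 hnc Finset.univ
  have hPv := coeff_prod_one_add_of_not_composite v hv0 (fun j => (u j).support ∪ (v j).support)
    (fun j => Finset.subset_union_right) e he0 hnc Finset.univ
  unfold tailDiff at hcoeff
  rw [coeff_sub, hPu, hPv] at hcoeff
  exact sub_eq_zero.1 hcoeff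

end Summit.ValiantsHypothesis.ValiantsHypothesis.Theorems.NewtonUnitEquations.TwoProducts.Submerged

end
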